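import Literature.AlgebraicTopology.SingularHomology.HomologySelfMapFixingOpenSetRelations
import Literature.Geometry.ComplexAnalytic.PhamBrieskornFibreEigenvector
import Literature.AlgebraicGeometry.HodgeTheory.ComplexBettiMapOfRationalBijective
import Literature.AlgebraicGeometry.Motives.UniversalHypersurfaceFibre
import HarnessLib

/-!
# A monodromy homeomorphism localising to a Pham–Brieskorn rotation of order four whose square is a non-trivial
# coordinate rotation is NOT unipotent on rational cohomology (socket S1 of the programme A₃-TRACE)

Family `hodge`, layer `Literature/AlgebraicGeometry/HodgeTheory`; theorems only (no definition, no named fact). Written by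
the prover seat `hodge-nonav-prover-Bx` (g16, cell `hodge-nonav`) for the binder hN `SymmetricA3NonCommutation`
(`stub_a3NonComm`) of crux K1-B `VeryGeneralSignCommutatorsInHg`
(`Summits/HodgeConjecture/HodgeConjecture/Theses/SignSymmetricPowers.lean`, stmt-HodgeConjecture-19716); programme memo
`HOME/memos/PROGRAMME-A3-TRACE-Bx-g16.md` §1 (3)–(5). It is the GEOMETRY-FREE half of the statement «THE rational transport
around the symmetric `A₃` point is not unipotent»: all analysis (the monodromy homeomorphism, its support in a Milnor ball, the
chart to the Pham–Brieskorn fibre and the homotopy to the weighted rotation) enters as hypotheses of the shape the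
localisation ports deliver (`NodalPencil*`, `CyclicCoverPencil*`).

**Theorem** `not_isNilpotent_sub_one_of_localisedRotation`. Let `Y` be a space with `Hₙ(Y; ℚ)` and `Hₙ(Y; ℂ)` finite-
dimensional (`n = m + 1`), `Y = A ∪ B` an open cover, `h : Y ≃ₜ Y` with `h = id` on `B` and `h(A) ⊆ A` (restriction `h_A`),
`e : A → F₀ = {Σ zᵢ^{aᵢ} = 1}` (all `aᵢ ≥ 2`, `m + 2` coordinates) BIJECTIVE on `Hₙ( · ; ℂ)` with `e ∘ h_A ≃ g ∘ e` for a self-map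
`g` of `F₀` such that `g⁴ = id` and `g² = ` the rotation of the last coordinate by some `v ∈ Ω_{a_last}`, `v ≠ 1`. Then no
automorphism `T` of `Hⁿ(Y; ℚ)` acting as `h^*` has `T − 1` nilpotent.

**Proof.** If `(T − 1)^k = 0` then `(h^*_ℂ − 1)^k = 0` on `Hⁿ(Y; ℂ)` (universal coefficients: `ℂ ⊗ Hⁿ(Y; ℚ) ↠ Hⁿ(Y; ℂ)`,
tree `ofRatClassBaseChange_bijective`, and naturality `ofRatClass_map`); by the DESCENT theorem
`singularCohomology.aeval_X_mul_modelMap_sub_id_eq_zero_of_eqOn` (excision: global relations of a map fixing `B` descend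
to the model) `(g_* − 1)^{k+1} = 0` on `Hₙ(F₀; ℂ)`; with `g_*⁴ = 1` this forces `g_* = 1` (a unipotent element of finite order
is trivial in characteristic zero: `LinearMap.eq_one_of_isNilpotent_sub_one_of_pow_eq_one`), hence `(g²)_* = 1`, i.e. the
rotation by `v` acts trivially on `Hₙ(F₀; ℂ)` — contradicting Pham's eigenvector (`PhamBrieskorn.map_rotateFibre_ne_id`).

* `finite_singularHomology_complex_complexPoints` — `Hₖ(X(ℂ); ℂ)` is finite-dimensional for `X` smooth projective
  (compact topological manifold; the `ℚ`/`ℤ` versions are in the tree);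
* `not_isNilpotent_sub_one_of_localisedRotation_fiberOver` — the universal-family form (`Y = Y_s(ℂ)`, `T` on
  `bettiCohomology (fiberOver (family ℂ (m+1) d) s) (m+1)`), the shape consumed by `symmetricA3NonCommutation_of_not_isNilpotent`.

Nothing here constructs the homeomorphism or the chart (brick B4 of the memo); HC not proved; rung F-H1 not moved.

## References

* [ArnoldGuseinzadeVarchenko2012] V. I. Arnold, S. M. Gusein-Zade, A. N. Varchenko, Singularities of Differentiable Maps II,
  Part I §1.1 (variation, `h_* = id + var ∘ i_*`), §2.3 (monodromy of a quasi-homogeneous singularity), §5.2.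
* [Milnor1968] J. Milnor, Singular Points of Complex Hypersurfaces, §9 Thm. 9.1, Lemma 9.4.
* [HatcherAT2002] A. Hatcher, Algebraic Topology, CUP 2002, §2.1 Thm. 2.20, §3.1 Thm. 3.2 and p. 198, App. A Cor. A.8–A.9.
-/

noncomputable section

open CategoryTheory Set Polynomial Function
open scoped TensorProduct
open Literature.AlgebraicTopology.SingularHomology
open Literature.Geometry.ComplexAnalytic
open Literature.AlgebraicGeometry.Motives

namespace Literature.AlgebraicGeometry.HodgeTheory

/-! ### §1 Algebra: a unipotent automorphism of finite order four is the identity -/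

/-- **A unipotent endomorphism with `g⁴ = 1` is the identity** (vector spaces over a field of characteristic zero):
`g⁴ − 1 = (g − 1)·(4 + 6N + 4N² + N³)`, `N = g − 1`, and the second factor is `4 +` (nilpotent) — a unit.
[cite: ArnoldGuseinzadeVarchenko2012, Part I §2.3] -/
theorem _root_.LinearMap.eq_one_of_isNilpotent_sub_one_of_pow_four_eq_one {K : Type*} [Field K] [CharZero K]
    {V : Type*} [AddCommGroup V] [Module K V] {g : Module.End K V} (hnil : IsNilpotent (g - 1)) (h4 : g ^ 4 = 1) :
    g = 1 := by
  set N : Module.End K V := g - 1 with hN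
  have hg : g = N + 1 := by rw [hN, sub_add_cancel]
  -- `N * (4 + N * q) = 0` with `q = 6 + 4 N + N²`
  have hrel : N * (4 + N * (6 + 4 * N + N ^ 2)) = 0 := by
    have h := h4
    rw [hg] at h
    have hid : (N + 1) ^ 4 - 1 = N * (4 + N * (6 + 4 * N + N ^ 2)) := by noncomm_ring
    rw [← hid, h, sub_self]
  -- the second factor is a unit
  have hcommq : Commute N (6 + 4 * N + N ^ 2) :=
    ((Commute.ofNat_right N 6).add_right ((Commute.ofNat_right N 4).mul_right (Commute.refl N))).add_right
      (Commute.pow_right (Commute.refl N) 2)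
  have hnilNq : IsNilpotent (N * (6 + 4 * N + N ^ 2)) := hcommq.isNilpotent_mul_right hnil
  have h4unit : IsUnit (4 : Module.End K V) := by
    have h : (4 : Module.End K V) = algebraMap K (Module.End K V) 4 := by rw [map_ofNat]
    rw [h]
    exact (isUnit_iff_ne_zero.2 (by norm_num : (4 : K) ≠ 0)).map _
  have hcomm4 : Commute (N * (6 + 4 * N + N ^ 2)) 4 := Commute.ofNat_right _ 4
  have hunit : IsUnit (4 + N * (6 + 4 * N + N ^ 2)) := hnilNq.isUnit_add_left_of_commute h4unit hcomm4
  have hN0 : N = 0 := (hunit.mul_left_eq_zero).1 hrel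
  rw [hg, hN0, zero_add]

/-! ### §2 `Hₖ(X(ℂ); ℂ)` is finite-dimensional for `X` smooth projective -/

/-- **`Hₖ(X(ℂ); ℂ)` is finite-dimensional** for `X` smooth projective of dimension `n` over `ℂ`: `X(ℂ)` is a compact
Hausdorff topological `2n`-manifold (the tree's `finite_singularHomology_rat_complexPoints` with `ℂ` coefficients).
[cite: HatcherAT2002, App. A Cor. A.8 and A.9 p. 527] -/
theorem finite_singularHomology_complex_complexPoints {n : ℕ} {X : Motives.SchemeOver ℂ}
    (hX : Motives.IsSmoothProjective n X) (k : ℕ) :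
    Module.Finite ℂ (singularHomology ℂ ℂ (Motives.ComplexPoints X) k) := by
  haveI := hX.smoothOfRelativeDimension
  haveI : AlgebraicGeometry.Smooth X.hom := AlgebraicGeometry.SmoothOfRelativeDimension.smooth n X.hom
  choose chart mem _ using fun P : Motives.ComplexPoints X ↦
    Literature.NumberTheory.Transcendental.exists_algebraicChart_holds X n P
  let eC : (Fin n → ℂ) ≃ₜ EuclideanSpace ℝ (Fin (2 * n)) :=
    (ContinuousLinearEquiv.ofFinrankEq (𝕜 := ℝ) (by
      rw [Module.finrank_pi_fintype, finrank_euclideanSpace_fin]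
      simp [Complex.finrank_real_complex, mul_comm])).toHomeomorph
  letI : ChartedSpace (EuclideanSpace ℝ (Fin (2 * n))) (Motives.ComplexPoints X) :=
    { atlas := Set.range fun P ↦ (chart P).transHomeomorph eC
      chartAt := fun P ↦ (chart P).transHomeomorph eC
      mem_chart_source := fun P ↦ by
        rw [OpenPartialHomeomorph.transHomeomorph_source]; exact mem P
      chart_mem_atlas := fun P ↦ ⟨P, rfl⟩ }
  haveI : AlgebraicGeometry.IsProper X.hom := Motives.IsSmoothProjective.isProper_holds hX
  haveI : CompactSpace (Motives.ComplexPoints X) :=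
    Motives.compactSpace_algPoints_of_isProper_holds X ℂ
  haveI : T2Space (Motives.ComplexPoints X) := Motives.ComplexPoints.t2Space_of_isSeparated X
  exact finite_singularHomology_of_compact_chartedSpace ℂ ℂ (d := 2 * n) k

/-! ### §3 The socket: a localised rotation model forbids unipotent monodromy -/

section Socket

variable {m : ℕ} {Y : Type} [TopologicalSpace Y]

/-- Powers of `h^*_ℂ − 1` on rational classes are the complexified powers of `h^*_ℚ − 1` (naturality of the change of
coefficients `ofRatClass`). [cite: HatcherAT2002, §3.1 p. 198] -/
private theorem pow_sub_id_ofRatClass (h : C(Y, Y)) (n j : ℕ) (a : singularCohomology ℚ ℚ Y n) :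
    (((singularCohomology.map ℂ ℂ h n).hom - LinearMap.id : Module.End ℂ (singularCohomology ℂ ℂ Y n)) ^ j)
        (ofRatClass Y n a) =
      ofRatClass Y n
        ((((singularCohomology.map ℚ ℚ h n).hom - LinearMap.id : Module.End ℚ (singularCohomology ℚ ℚ Y n)) ^ j) a) := by
  induction j generalizing a with
  | zero => rw [pow_zero, pow_zero, Module.End.one_apply, Module.End.one_apply]
  | succ j ih =>
    rw [pow_succ, pow_succ, Module.End.mul_apply, Module.End.mul_apply, LinearMap.sub_apply, LinearMap.id_apply,
      ← ofRatClass_map, ← map_sub, ih]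
    rfl

/-- **Socket S1 of A₃-TRACE: a monodromy homeomorphism localising to a Pham–Brieskorn rotation `g` with `g⁴ = id` and
`g²` a non-trivial rotation of the last coordinate is not unipotent on `Hⁿ(Y; ℚ)`** (module docstring).
[cite: ArnoldGuseinzadeVarchenko2012, Part I §1.1 and §2.3] [cite: Milnor1968, §9 Thm. 9.1 and Lemma 9.4]
[cite: HatcherAT2002, §2.1 Thm. 2.20 and §3.1 p. 198] -/
theorem not_isNilpotent_sub_one_of_localisedRotation
    [Module.Finite ℚ (singularHomology ℚ ℚ Y (m + 1))] [Module.Finite ℂ (singularHomology ℂ ℂ Y (m + 1))]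
    {A B : Set Y} (hAo : IsOpen A) (hBo : IsOpen B) (hAB : A ∪ B = univ) (h : Y ≃ₜ Y) (hB : ∀ y ∈ B, h y = y)
    (hA : C(↥A, ↥A)) (hhA : ∀ x : ↥A, ((hA x : ↥A) : Y) = h x)
    {a : Fin (m + 2) → ℕ} (h2 : ∀ i, 2 ≤ a i) (e : C(↥A, ↥(PhamBrieskorn.fibre a)))
    (hbij : Bijective (singularHomology.map ℂ ℂ e (m + 1)).hom)
    (g : C(↥(PhamBrieskorn.fibre a), ↥(PhamBrieskorn.fibre a))) (hconj : (e.comp hA).Homotopic (g.comp e))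
    (hg4 : ∀ z, g (g (g (g z))) = z) (v : PhamBrieskorn.Omega (a (Fin.last (m + 1)))) (hv : (v : ℂ) ≠ 1)
    (hg2 : ∀ z, g (g z) = PhamBrieskorn.rotateFibre a (fun i => by have := h2 i; omega) v z)
    (T : singularCohomology ℚ ℚ Y (m + 1) ≃ₗ[ℚ] singularCohomology ℚ ℚ Y (m + 1))
    (hT : ∀ x, T x = (singularCohomology.map ℚ ℚ (h : C(Y, Y)) (m + 1)).hom x) :
    ¬ IsNilpotent ((T : singularCohomology ℚ ℚ Y (m + 1) →ₗ[ℚ] singularCohomology ℚ ℚ Y (m + 1)) - 1) := by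
  rintro ⟨k, hk⟩
  have ha : ∀ i, a i ≠ 0 := fun i => by have := h2 i; omega
  -- (1) `T = h^*_ℚ` as a linear map, so `(h^*_ℚ − 1)^k = 0`
  have hTeq : (T : singularCohomology ℚ ℚ Y (m + 1) →ₗ[ℚ] singularCohomology ℚ ℚ Y (m + 1)) =
      (singularCohomology.map ℚ ℚ (h : C(Y, Y)) (m + 1)).hom := LinearMap.ext fun x => hT x
  have hkQ : (((singularCohomology.map ℚ ℚ (h : C(Y, Y)) (m + 1)).hom - LinearMap.id :
      Module.End ℚ (singularCohomology ℚ ℚ Y (m + 1))) ^ k) = 0 := by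
    rw [← hTeq]; exact hk
  -- (2) complexification: `(h^*_ℂ − 1)^k = 0` on `Hⁿ(Y; ℂ)`
  let TC : singularCohomology ℂ ℂ Y (m + 1) ≃ₗ[ℂ] singularCohomology ℂ ℂ Y (m + 1) :=
    (singularCohomology.mapIso ℂ ℂ h (m + 1)).toLinearEquiv
  have hTC : ∀ x, TC x = (singularCohomology.map ℂ ℂ (h : C(Y, Y)) (m + 1)).hom x := fun x => rfl
  have hkC : aeval ((TC : singularCohomology ℂ ℂ Y (m + 1) →ₗ[ℂ] singularCohomology ℂ ℂ Y (m + 1)) - LinearMap.id)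
      ((X : ℂ[X]) ^ k) = 0 := by
    rw [aeval_X_pow]
    have hTCeq : (TC : singularCohomology ℂ ℂ Y (m + 1) →ₗ[ℂ] singularCohomology ℂ ℂ Y (m + 1)) =
        (singularCohomology.map ℂ ℂ (h : C(Y, Y)) (m + 1)).hom := LinearMap.ext fun x => hTC x
    rw [hTCeq]
    refine LinearMap.ext fun c => ?_
    rw [LinearMap.zero_apply]
    obtain ⟨t, rfl⟩ := (ofRatClassBaseChange_bijective Y (m + 1)).2 c
    induction t using TensorProduct.induction_on with
    | zero => rw [map_zero, map_zero]
    | tmul c₀ x =>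
      rw [ofRatClassBaseChange_tmul, map_smul, pow_sub_id_ofRatClass, hkQ, LinearMap.zero_apply, map_zero, smul_zero]
    | add x y hx hy => rw [map_add, map_add, hx, hy, add_zero]
  -- (3) descent to the model: `(g_* − 1)^(k+1) = 0` on `Hₙ(F₀; ℂ)`
  have hdesc := singularCohomology.aeval_X_mul_modelMap_sub_id_eq_zero_of_eqOn ℂ hAo hBo hAB (h : C(Y, Y)) hB hA hhA
    (m + 1) e hbij g hconj TC hTC hkC
  rw [← pow_succ', aeval_X_pow] at hdesc
  -- (4) `g_*⁴ = 1`, so `g_* = 1`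
  set G : Module.End ℂ (singularHomology ℂ ℂ (↥(PhamBrieskorn.fibre a)) (m + 1)) :=
    (singularHomology.map ℂ ℂ g (m + 1)).hom with hG
  have hg4' : g.comp (g.comp (g.comp g)) = ContinuousMap.id _ := by
    ext z : 1
    exact hg4 z
  have hG4 : G ^ 4 = 1 := by
    have h1 : singularHomology.map ℂ ℂ (g.comp (g.comp (g.comp g))) (m + 1) = 𝟙 _ := by
      rw [hg4', singularHomology.map_id]
    rw [singularHomology.map_comp, singularHomology.map_comp, singularHomology.map_comp] at h1
    have h' := congrArg ModuleCat.Hom.hom h1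
    simp only [ModuleCat.hom_comp, ModuleCat.hom_id] at h'
    rw [show (4 : ℕ) = 1 + 1 + 1 + 1 from rfl, pow_succ, pow_succ, pow_succ, pow_one]
    exact h'
  have hG1 : G = 1 := LinearMap.eq_one_of_isNilpotent_sub_one_of_pow_four_eq_one ⟨k + 1, hdesc⟩ hG4
  -- (5) hence the rotation by `v` is trivial on `Hₙ(F₀; ℂ)`: contradiction with Pham's eigenvector
  have hrot : (singularHomology.map ℂ ℂ
      (PhamBrieskorn.rotateFibre a ha v : C(↥(PhamBrieskorn.fibre a), ↥(PhamBrieskorn.fibre a))) (m + 1)).hom =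
      LinearMap.id := by
    have hgg2 : (PhamBrieskorn.rotateFibre a ha v : C(↥(PhamBrieskorn.fibre a), ↥(PhamBrieskorn.fibre a))) = g.comp g := by
      ext z : 1
      exact (hg2 z).symm
    rw [hgg2, singularHomology.map_comp, ModuleCat.hom_comp]
    change G * G = 1
    rw [hG1, mul_one]
  exact PhamBrieskorn.map_rotateFibre_ne_id ha h2 v hv hrot

end Socket

/-! ### §4 The universal-family form -/

variable {m : ℕ}

/-- **Socket S1 for the universal family of hypersurfaces**: for a fibre `Y_s` of the universal family of smooth degree-`d`
hypersurfaces in `ℙᵐ⁺²` (`d ≥ 1`) and THE rational transport `T` along a loop at `s` acting as `η^*` for a monodromy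
homeomorphism `η` of `Y_s(ℂ)` that is the identity off an open `A` and, on `A`, conjugate through a chart bijective on
`Hₘ₊₁( · ; ℂ)` to a self-map `g` of the Pham–Brieskorn fibre with `g⁴ = id` and `g²` a non-trivial rotation of the last
coordinate: `T − 1` is not nilpotent. [cite: ArnoldGuseinzadeVarchenko2012, Part I §1.1, §2.3 and §5.2]
[cite: Milnor1968, §9 Thm. 9.1 and Lemma 9.4] -/
theorem not_isNilpotent_sub_one_of_localisedRotation_fiberOver {d : ℕ} (hd : 1 ≤ d)
    {s : ComplexPoints (UniversalHypersurface.base ℂ (m + 1) d)}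
    {A B : Set (ComplexPoints (fiberOver (UniversalHypersurface.family ℂ (m + 1) d) s))} (hAo : IsOpen A)
    (hBo : IsOpen B) (hAB : A ∪ B = univ)
    (η : ComplexPoints (fiberOver (UniversalHypersurface.family ℂ (m + 1) d) s) ≃ₜ
      ComplexPoints (fiberOver (UniversalHypersurface.family ℂ (m + 1) d) s))
    (hB : ∀ y ∈ B, η y = y) (hA : C(↥A, ↥A)) (hhA : ∀ x : ↥A, ((hA x : ↥A) : _) = η x)
    {a : Fin (m + 2) → ℕ} (h2 : ∀ i, 2 ≤ a i) (e : C(↥A, ↥(PhamBrieskorn.fibre a)))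
    (hbij : Bijective (singularHomology.map ℂ ℂ e (m + 1)).hom)
    (g : C(↥(PhamBrieskorn.fibre a), ↥(PhamBrieskorn.fibre a))) (hconj : (e.comp hA).Homotopic (g.comp e))
    (hg4 : ∀ z, g (g (g (g z))) = z) (v : PhamBrieskorn.Omega (a (Fin.last (m + 1)))) (hv : (v : ℂ) ≠ 1)
    (hg2 : ∀ z, g (g z) = PhamBrieskorn.rotateFibre a (fun i => by have := h2 i; omega) v z)
    (T : bettiCohomology (fiberOver (UniversalHypersurface.family ℂ (m + 1) d) s) (m + 1) ≃ₗ[ℚ]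
      bettiCohomology (fiberOver (UniversalHypersurface.family ℂ (m + 1) d) s) (m + 1))
    (hT : ∀ x, T x = (singularCohomology.map ℚ ℚ
      (η : C(ComplexPoints (fiberOver (UniversalHypersurface.family ℂ (m + 1) d) s),
        ComplexPoints (fiberOver (UniversalHypersurface.family ℂ (m + 1) d) s))) (m + 1)).hom x) :
    ¬ IsNilpotent ((T : bettiCohomology (fiberOver (UniversalHypersurface.family ℂ (m + 1) d) s) (m + 1) →ₗ[ℚ]
      bettiCohomology (fiberOver (UniversalHypersurface.family ℂ (m + 1) d) s) (m + 1)) - 1) := by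
  have hX : Motives.IsSmoothProjective (m + 1) (fiberOver (UniversalHypersurface.family ℂ (m + 1) d) s) :=
    (UniversalHypersurface.isSmoothProjectiveFamily_family ℂ (Nat.succ_pos m) hd).isSmoothProjective s
  haveI := finite_singularHomology_rat_complexPoints hX (m + 1)
  haveI := finite_singularHomology_complex_complexPoints hX (m + 1)
  exact not_isNilpotent_sub_one_of_localisedRotation hAo hBo hAB η hB hA hhA h2 e hbij g hconj hg4 v hv hg2 T hT

end Literature.AlgebraicGeometry.HodgeTheory

end
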